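import Summits.NavierStokesRegularity.NavierStokesRegularity.Theses.RellichScar
import Summits.NavierStokesRegularity.NavierStokesRegularity.Theorems.ScarRigidity.Negative.LogicAndLoadBearing
import Summits.NavierStokesRegularity.NavierStokesRegularity.Theorems.RellichScarDefs
import Literature.Analysis.FluidPDE.TypeIAncientMild
import HarnessLib

/-!
# `ScarRigidity`, line `moment-conditioned-rellich` — stub `stub_farFieldAllOrders` (S-far)

Crux stmt-NavierStokesRegularity-11717 (route RellichScar), skeleton
`Summit.NavierStokesRegularity.NavierStokesRegularity.Theorems.RellichScarScarRigidity`.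
Two classical Navier–Stokes pairs on the open backward slab `(-∞,0) × ℝ³` with the scale-invariant bound
package (`ScaleInvariantBounds`, `Theorems/RellichScarDefs.lean`) and the SAME SCAR (`SameScar V₁ V₂`) are
cubically flat on the parabolic exterior with all spatial derivatives (`FarDecay 3 V₁ V₂`):
`‖∇ᵏ(V₁(t) − V₂(t))(x)‖ ≤ K (√(−t))⁻¹ (√(−t)/‖x‖)³ / ‖x‖ᵏ = K(−t)/‖x‖^{3+k}` for `√(−t) ≤ ‖x‖`.

Proof (elementary; only joint smoothness is used from `IsClassicalNSSolutionOn`).  Fix `k`, `x ≠ 0`,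
`g(s) = ∇ᵏV₁(s,x) − ∇ᵏV₂(s,x)`.  (1) `s ↦ ∇ᵏVᵢ(s,x)` is differentiable on `s < 0` (spatial derivatives of a
jointly smooth field are jointly smooth) and `‖g′‖ ≤ (L₁+L₂)/‖x‖^{3+k}`, so `‖g(t) − g(s)‖ ≤ (L₁+L₂)|t−s|/‖x‖^{3+k}`
(mean value inequality).  (2) `g(s) → 0` as `s ↑ 0` (`stub_farFieldAllOrders_sliceLimit`, registered sub-goal),
by induction on `k`: the scar made pointwise by continuity (`k = 0`, adapted from the drefuter's
`Cruxes/ScarRigidity/DrefuteS1bProof.lean`); for `k + 1` the maps `∇ᵏ(V₁−V₂)(s,·)` tend to `0` pointwise on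
`ball x (‖x‖/2)` while their derivatives are uniformly Cauchy in `s` (step 1), so the derivatives tend to the
derivative of the limit `0` (Mathlib `hasFDerivAt_of_tendstoUniformlyOnFilter`).  (3) Let `s ↑ 0` in (1):
`‖g(t)‖ ≤ (L₁+L₂)(−t)/‖x‖^{3+k}`, the claim with `K = L₁+L₂` since `(√(−t))² = −t`.
-/

noncomputable section

open Set Filter Function MeasureTheory Metric TopologicalSpace
open scoped Topology ENNReal NNReal InnerProductSpace RealInnerProductSpace Laplacian
open Literature.Analysis.FluidPDE
open Summit.NavierStokesRegularity.NavierStokesRegularity.Theses.RellichScar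
open Summit.NavierStokesRegularity.NavierStokesRegularity.Theorems.ScarRigidity.Negative

set_option linter.dupNamespace false -- D-0017: `Summit.<S>.<S>.…` repeats the summit name by design

namespace Summit.NavierStokesRegularity.NavierStokesRegularity.Theorems.RellichScarScarRigidity

/-- Physical space. -/
local notation "ℝ³" => EuclideanSpace ℝ (Fin 3)

/-- The spatial derivatives `(s, y) ↦ ∇ᵏV(s,·)(y)` of a field jointly smooth on the open backward slab are
jointly smooth there (induction on `k` through Mathlib's parametric `ContDiffAt.fderiv`). [folklore] -/
theorem contDiffAt_uncurry_iteratedFDeriv {V : ℝ → ℝ³ → ℝ³}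
    (hV : IsSmoothSpaceTimeOn (Iio (0 : ℝ)) V) (k : ℕ) {p : ℝ × ℝ³} (hp : p.1 < 0) :
    ContDiffAt ℝ (⊤ : ℕ∞) (fun q : ℝ × ℝ³ => iteratedFDeriv ℝ k (V q.1) q.2) p := by
  induction k generalizing p with
  | zero =>
    have h1 : ContDiffAt ℝ (⊤ : ℕ∞) (uncurry V) p := ContDiffOn.contDiffAt hV
      ((isOpen_Iio.prod isOpen_univ).mem_nhds (mem_prod.2 ⟨hp, mem_univ _⟩))
    have h5 : (fun q : ℝ × ℝ³ => iteratedFDeriv ℝ 0 (V q.1) q.2) =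
        (continuousMultilinearCurryFin0 ℝ ℝ³ ℝ³).symm ∘ uncurry V := by funext q; rfl
    rw [h5]
    exact (continuousMultilinearCurryFin0 ℝ ℝ³ ℝ³).symm.contDiff.comp_contDiffAt p h1
  | succ k ih =>
    have h1 : ContDiffAt ℝ (⊤ : ℕ∞)
        (uncurry fun (q : ℝ × ℝ³) (y : ℝ³) => iteratedFDeriv ℝ k (V q.1) y) (p, p.2) := by
      have h2 : ContDiffAt ℝ (⊤ : ℕ∞) (fun q : (ℝ × ℝ³) × ℝ³ => ((q.1.1, q.2) : ℝ × ℝ³)) (p, p.2) :=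
        ((contDiff_fst.comp contDiff_fst).prodMk contDiff_snd).contDiffAt
      have h3 : ContDiffAt ℝ (⊤ : ℕ∞) (fun q : ℝ × ℝ³ => iteratedFDeriv ℝ k (V q.1) q.2)
          ((fun q : (ℝ × ℝ³) × ℝ³ => ((q.1.1, q.2) : ℝ × ℝ³)) (p, p.2)) := ih hp
      exact h3.comp (p, p.2) h2
    have h4 : ContDiffAt ℝ (⊤ : ℕ∞)
        (fun q : ℝ × ℝ³ => fderiv ℝ (fun y => iteratedFDeriv ℝ k (V q.1) y) q.2) p :=
      ContDiffAt.fderiv (f := fun (q : ℝ × ℝ³) (y : ℝ³) => iteratedFDeriv ℝ k (V q.1) y)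
        (g := fun q : ℝ × ℝ³ => q.2) h1 contDiffAt_snd (by simp)
    have h5 : (fun q : ℝ × ℝ³ => iteratedFDeriv ℝ (k + 1) (V q.1) q.2) =
        (continuousMultilinearCurryLeftEquiv ℝ (fun _ : Fin (k + 1) => ℝ³) ℝ³).symm ∘
          (fun q : ℝ × ℝ³ => fderiv ℝ (fun y => iteratedFDeriv ℝ k (V q.1) y) q.2) := by funext q; rfl
    rw [h5]
    exact (continuousMultilinearCurryLeftEquiv ℝ (fun _ : Fin (k + 1) => ℝ³) ℝ³).symm.contDiff.comp_contDiffAt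
      p h4

/-- Time lines `s ↦ ∇ⁿV(s,·)(x)` of a jointly smooth field are differentiable at negative times. [folklore] -/
theorem differentiableAt_iteratedFDeriv_slice {V : ℝ → ℝ³ → ℝ³}
    (hV : IsSmoothSpaceTimeOn (Iio (0 : ℝ)) V) (n : ℕ) (x : ℝ³) {s : ℝ} (hs : s < 0) :
    DifferentiableAt ℝ (fun τ => iteratedFDeriv ℝ n (V τ) x) s := by
  have h1 : DifferentiableAt ℝ (fun q : ℝ × ℝ³ => iteratedFDeriv ℝ n (V q.1) q.2) (s, x) :=
    (contDiffAt_uncurry_iteratedFDeriv hV n (p := (s, x)) hs).differentiableAt (by simp)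
  have h2 : DifferentiableAt ℝ (fun τ : ℝ => ((τ, x) : ℝ × ℝ³)) s := differentiableAt_id.prodMk (differentiableAt_const x)
  exact h1.comp s h2

/-- Linearity on the smooth slices: `∇ⁿ(V₁(s) − V₂(s)) = ∇ⁿV₁(s) − ∇ⁿV₂(s)` for `s < 0`. [folklore] -/
theorem iteratedFDeriv_sub_slice {V₁ V₂ : ℝ → ℝ³ → ℝ³}
    (hV₁ : IsSmoothSpaceTimeOn (Iio (0 : ℝ)) V₁) (hV₂ : IsSmoothSpaceTimeOn (Iio (0 : ℝ)) V₂)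
    (n : ℕ) {s : ℝ} (hs : s < 0) (y : ℝ³) :
    iteratedFDeriv ℝ n (fun z => V₁ s z - V₂ s z) y =
      iteratedFDeriv ℝ n (V₁ s) y - iteratedFDeriv ℝ n (V₂ s) y := by
  have h₁ : ContDiff ℝ n (V₁ s) := (hV₁.contDiff_slice (t := s) hs).of_le (by exact_mod_cast le_top)
  have h₂ : ContDiff ℝ n (V₂ s) := (hV₂.contDiff_slice (t := s) hs).of_le (by exact_mod_cast le_top)
  exact fun_iteratedFDeriv_sub_apply h₁.contDiffAt h₂.contDiffAt

/-- A bound `‖∂ₜ∇ⁿV‖ ≤ L/(‖x‖+√(−t))^{3+n}` on the slab forces `0 ≤ L` (evaluate at `(t,x) = (−1,0)`). [folklore] -/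
theorem nonneg_of_timeDeriv_bound {V : ℝ → ℝ³ → ℝ³} {n : ℕ} {L : ℝ}
    (h : ∀ t < 0, ∀ x : ℝ³,
      ‖deriv (fun s => iteratedFDeriv ℝ n (V s) x) t‖ ≤ L / (‖x‖ + Real.sqrt (-t)) ^ (3 + n)) :
    0 ≤ L := by
  have h1 := h (-1) (by norm_num) 0
  rw [norm_zero, zero_add, neg_neg, Real.sqrt_one, one_pow, div_one] at h1
  exact (norm_nonneg _).trans h1

/-- **Mean value inequality in time** for `g(s) = ∇ⁿV₁(s,x) − ∇ⁿV₂(s,x)`: the bounds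
`‖∂ₜ∇ⁿVᵢ‖ ≤ Lᵢ/(‖x‖+√(−s))^{3+n} ≤ Lᵢ/ρ^{3+n}` (`ρ ≤ ‖x‖`) give `‖g(t) − g(s)‖ ≤ (L₁+L₂)|t−s|/ρ^{3+n}`
(Mathlib `Convex.norm_image_sub_le_of_norm_deriv_le` on `Iio 0`). [folklore] -/
theorem norm_iteratedFDeriv_sub_sub_le {V₁ V₂ : ℝ → ℝ³ → ℝ³}
    (hV₁ : IsSmoothSpaceTimeOn (Iio (0 : ℝ)) V₁) (hV₂ : IsSmoothSpaceTimeOn (Iio (0 : ℝ)) V₂)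
    {n : ℕ} {L₁ L₂ ρ : ℝ} (hL₁ : 0 ≤ L₁) (hL₂ : 0 ≤ L₂) (hρ : 0 < ρ)
    (hd₁ : ∀ t < 0, ∀ x : ℝ³,
      ‖deriv (fun s => iteratedFDeriv ℝ n (V₁ s) x) t‖ ≤ L₁ / (‖x‖ + Real.sqrt (-t)) ^ (3 + n))
    (hd₂ : ∀ t < 0, ∀ x : ℝ³,
      ‖deriv (fun s => iteratedFDeriv ℝ n (V₂ s) x) t‖ ≤ L₂ / (‖x‖ + Real.sqrt (-t)) ^ (3 + n))
    {x : ℝ³} (hx : ρ ≤ ‖x‖) {s t : ℝ} (hs : s < 0) (ht : t < 0) :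
    ‖(iteratedFDeriv ℝ n (V₁ t) x - iteratedFDeriv ℝ n (V₂ t) x) -
        (iteratedFDeriv ℝ n (V₁ s) x - iteratedFDeriv ℝ n (V₂ s) x)‖ ≤
      (L₁ + L₂) / ρ ^ (3 + n) * |t - s| := by
  set g : ℝ → (ℝ³ [×n]→L[ℝ] ℝ³) :=
    fun τ => iteratedFDeriv ℝ n (V₁ τ) x - iteratedFDeriv ℝ n (V₂ τ) x with hg
  have hdiff : ∀ τ ∈ Iio (0 : ℝ), DifferentiableAt ℝ g τ := fun τ hτ =>
    (differentiableAt_iteratedFDeriv_slice hV₁ n x hτ).sub (differentiableAt_iteratedFDeriv_slice hV₂ n x hτ)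
  have hbound : ∀ τ ∈ Iio (0 : ℝ), ‖deriv g τ‖ ≤ (L₁ + L₂) / ρ ^ (3 + n) := by
    intro τ hτ
    have hτ' : τ < 0 := hτ
    rw [show deriv g τ = _ from deriv_sub (differentiableAt_iteratedFDeriv_slice hV₁ n x hτ')
      (differentiableAt_iteratedFDeriv_slice hV₂ n x hτ')]
    have hpow : ρ ^ (3 + n) ≤ (‖x‖ + Real.sqrt (-τ)) ^ (3 + n) :=
      pow_le_pow_left₀ hρ.le (hx.trans (le_add_of_nonneg_right (Real.sqrt_nonneg _))) _
    calc _ ≤ ‖deriv (fun σ => iteratedFDeriv ℝ n (V₁ σ) x) τ‖ + ‖deriv (fun σ => iteratedFDeriv ℝ n (V₂ σ) x) τ‖ :=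
          norm_sub_le _ _
      _ ≤ L₁ / (‖x‖ + Real.sqrt (-τ)) ^ (3 + n) + L₂ / (‖x‖ + Real.sqrt (-τ)) ^ (3 + n) :=
          add_le_add (hd₁ τ hτ' x) (hd₂ τ hτ' x)
      _ = (L₁ + L₂) / (‖x‖ + Real.sqrt (-τ)) ^ (3 + n) := (add_div _ _ _).symm
      _ ≤ (L₁ + L₂) / ρ ^ (3 + n) := div_le_div_of_nonneg_left (add_nonneg hL₁ hL₂) (pow_pos hρ _) hpow
  have hMVT : ‖g t - g s‖ ≤ (L₁ + L₂) / ρ ^ (3 + n) * ‖t - s‖ :=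
    (convex_Iio (0 : ℝ)).norm_image_sub_le_of_norm_deriv_le hdiff hbound hs ht
  rwa [Real.norm_eq_abs] at hMVT

/-- ESS-SUP SMALL + CONTINUOUS ⇒ POINTWISE SMALL: if `‖w‖ₑ < ε` a.e. on `S` (restricted Lebesgue measure) and
`w` is continuous on an open `U ⊆ S`, then `‖w z‖ ≤ ε` on `U` (else `U ∩ {‖w‖ > ε}` is open, non-null).
Adapted from `Cruxes/ScarRigidity/DrefuteS1bProof.lean` (`Refuter.Drefute.FELC.S1b.norm_le_of_ae_lt`). [folklore] -/
theorem norm_le_of_ae_lt {S U : Set (ℝ × ℝ³)} {w : ℝ × ℝ³ → ℝ³} {ε : ℝ} (hε : 0 ≤ ε)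
    (hU : IsOpen U) (hUS : U ⊆ S) (hw : ContinuousOn w U)
    (hsmall : ∀ᵐ z ∂(volume.restrict S), ‖w z‖ₑ < ENNReal.ofReal ε) {z : ℝ × ℝ³} (hz : z ∈ U) :
    ‖w z‖ ≤ ε := by
  by_contra hcon
  set A : Set (ℝ × ℝ³) := U ∩ (fun z => ‖w z‖) ⁻¹' Ioi ε with hA
  have hAopen : IsOpen A := (hw.norm).isOpen_inter_preimage hU isOpen_Ioi
  have hApos : 0 < volume A := hAopen.measure_pos volume ⟨z, ⟨hz, not_le.1 hcon⟩⟩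
  have hnull : volume.restrict S A = 0 := by
    refine measure_eq_zero_iff_ae_notMem.2 ?_
    filter_upwards [hsmall] with y hy hyA
    have h2 : ε < ‖w y‖ := hyA.2
    have h1 : ENNReal.ofReal ε < ‖w y‖ₑ := by
      rw [← ofReal_norm]
      exact (ENNReal.ofReal_lt_ofReal_iff (hε.trans_lt h2)).2 h2
    exact lt_irrefl _ (h1.trans hy)
  rw [Measure.restrict_apply hAopen.measurableSet, inter_eq_left.2 (fun y hy => hUS hy.1 : A ⊆ S)] at hnull
  exact absurd hnull hApos.ne'

/-- **The scar, pointwise** (`k = 0`): for jointly smooth fields with the same scar, `V₁(s,x) − V₂(s,x) → 0`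
as `s ↑ 0` for every `x ≠ 0` (scar on `closedBall x (‖x‖/2)`, then `norm_le_of_ae_lt` on the open box
`(−δ,0) × ball x (‖x‖/2)`; adapted from `Cruxes/ScarRigidity/DrefuteS1bProof.lean`, `stub_farFieldOfScar`). [folklore] -/
theorem tendsto_sub_of_sameScar {V₁ V₂ : ℝ → ℝ³ → ℝ³}
    (hV₁ : IsSmoothSpaceTimeOn (Iio (0 : ℝ)) V₁) (hV₂ : IsSmoothSpaceTimeOn (Iio (0 : ℝ)) V₂)
    (hscar : SameScar V₁ V₂) {x : ℝ³} (hx : x ≠ 0) :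
    Tendsto (fun s => V₁ s x - V₂ s x) (𝓝[<] (0 : ℝ)) (𝓝 0) := by
  have hxpos : 0 < ‖x‖ := norm_pos_iff.2 hx
  have hc₁ : ContinuousOn (uncurry V₁) (Iio (0 : ℝ) ×ˢ (univ : Set ℝ³)) := ContDiffOn.continuousOn hV₁
  have hc₂ : ContinuousOn (uncurry V₂) (Iio (0 : ℝ) ×ˢ (univ : Set ℝ³)) := ContDiffOn.continuousOn hV₂
  rw [Metric.tendsto_nhds]
  intro ε hε
  set K : Set ℝ³ := closedBall x (‖x‖ / 2) with hK
  have h0K : (0 : ℝ³) ∉ K := fun h0 => by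
    have : dist (0 : ℝ³) x ≤ ‖x‖ / 2 := mem_closedBall.1 h0
    rw [dist_eq_norm, zero_sub, norm_neg] at this
    linarith
  have hev : ∀ᶠ δ in 𝓝[>] (0 : ℝ), eLpNorm (uncurry V₁ - uncurry V₂) ⊤ (volume.restrict (Ioo (-δ) 0 ×ˢ K)) <
      ENNReal.ofReal (ε / 2) :=
    (tendsto_order.1 (hscar K (isCompact_closedBall _ _) h0K)).2 _ (ENNReal.ofReal_pos.2 (half_pos hε))
  obtain ⟨δ, hδN, hδpos⟩ := (hev.and eventually_mem_nhdsWithin).exists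
  have hδ0 : 0 < δ := hδpos
  filter_upwards [Ioo_mem_nhdsLT (show -δ < 0 by linarith)] with s hs
  set S : Set (ℝ × ℝ³) := Ioo (-δ) 0 ×ˢ K with hS
  have hSsub : S ⊆ Iio (0 : ℝ) ×ˢ (univ : Set ℝ³) := prod_mono Ioo_subset_Iio_self (subset_univ _)
  have hae_lt : ∀ᵐ z ∂(volume.restrict S), ‖(uncurry V₁ - uncurry V₂) z‖ₑ < ENNReal.ofReal (ε / 2) := by
    rw [eLpNorm_exponent_top] at hδN
    exact ae_lt_of_essSup_lt hδN
  set U : Set (ℝ × ℝ³) := Ioo (-δ) 0 ×ˢ ball x (‖x‖ / 2) with hU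
  have hUS : U ⊆ S := prod_mono Subset.rfl ball_subset_closedBall
  have hw : ContinuousOn (uncurry V₁ - uncurry V₂) U :=
    (hc₁.mono (hUS.trans hSsub)).sub (hc₂.mono (hUS.trans hSsub))
  have hzU : ((s, x) : ℝ × ℝ³) ∈ U := mk_mem_prod hs (mem_ball_self (half_pos hxpos))
  have h1 := norm_le_of_ae_lt (half_pos hε).le (isOpen_Ioo.prod isOpen_ball) hUS hw hae_lt hzU
  have h2 : ‖V₁ s x - V₂ s x‖ ≤ ε / 2 := by simpa using h1
  rw [dist_zero_right]
  linarith

/-- A family `F s`, `s < 0`, with values in a seminormed group which is `M`-Lipschitz in `s` uniformly on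
`U` is uniformly Cauchy on `U` as `s ↑ 0`. [folklore] -/
theorem uniformCauchySeqOn_nhdsLT_of_lipschitz {α X : Type*} [SeminormedAddCommGroup X]
    {F : ℝ → α → X} {U : Set α} {M : ℝ} (hM : 0 ≤ M)
    (h : ∀ y ∈ U, ∀ s < (0 : ℝ), ∀ t < (0 : ℝ), ‖F t y - F s y‖ ≤ M * |t - s|) :
    UniformCauchySeqOn F (𝓝[<] (0 : ℝ)) U := by
  intro u hu
  obtain ⟨ε, hε, hεu⟩ := Metric.mem_uniformity_dist.1 hu
  set δ : ℝ := ε / (2 * (M + 1)) with hδ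
  have hδ0 : 0 < δ := div_pos hε (by linarith)
  have hIoo : Ioo (-δ) (0 : ℝ) ∈ 𝓝[<] (0 : ℝ) := Ioo_mem_nhdsLT (by linarith)
  filter_upwards [prod_mem_prod hIoo hIoo] with p hp y hy
  apply hεu
  rw [mem_prod, mem_Ioo, mem_Ioo] at hp
  obtain ⟨⟨hp1, hp1'⟩, ⟨hp2, hp2'⟩⟩ := hp
  have habs : |p.1 - p.2| ≤ δ := by
    rw [abs_le]
    constructor <;> linarith
  have hMδ : (M + 1) * δ = ε / 2 := by
    rw [hδ]
    field_simp
  calc dist (F p.1 y) (F p.2 y) = ‖F p.1 y - F p.2 y‖ := dist_eq_norm _ _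
    _ ≤ M * |p.1 - p.2| := h y hy p.2 hp2' p.1 hp1'
    _ ≤ M * δ := mul_le_mul_of_nonneg_left habs hM
    _ ≤ (M + 1) * δ := mul_le_mul_of_nonneg_right (by linarith) hδ0.le
    _ < ε := by rw [hMδ]; exact half_lt_self hε

/-- **Limits of derivatives are derivatives of the limit, at `0`.**  If differentiable maps `φ i` tend to `0`
pointwise on a neighbourhood `U` of `x` along `l` and their derivatives are uniformly Cauchy on `U`, then
`fderiv (φ i) x → 0` (uniform convergence of the derivatives to some `G'` by completeness, and `G'` is the
derivative of the limit `0` by Mathlib `hasFDerivAt_of_tendstoUniformlyOnFilter`). [folklore] -/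
theorem tendsto_fderiv_zero_of_uniformCauchy {ι : Type*} {l : Filter ι} [NeBot l]
    {E : Type*} [NormedAddCommGroup E] [NormedSpace ℝ E]
    {G : Type*} [NormedAddCommGroup G] [NormedSpace ℝ G] [CompleteSpace G]
    {φ : ι → E → G} {x : E} {U : Set E} (hU : U ∈ 𝓝 x)
    (hdiff : ∀ᶠ i in l, ∀ y ∈ U, DifferentiableAt ℝ (φ i) y)
    (h0 : ∀ y ∈ U, Tendsto (fun i => φ i y) l (𝓝 0))
    (hC : UniformCauchySeqOn (fun i y => fderiv ℝ (φ i) y) l U) :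
    Tendsto (fun i => fderiv ℝ (φ i) x) l (𝓝 0) := by
  obtain ⟨G', hG't⟩ : ∃ G' : E → (E →L[ℝ] G),
      ∀ y ∈ U, Tendsto (fun i => fderiv ℝ (φ i) y) l (𝓝 (G' y)) :=
    ⟨fun y => limUnder l (fun i => fderiv ℝ (φ i) y), fun y hy =>
      tendsto_nhds_limUnder (cauchy_map_iff_exists_tendsto.1 (hC.cauchy_map hy))⟩
  have hf' : TendstoUniformlyOnFilter (fun i y => fderiv ℝ (φ i) y) G' l (𝓝 x) :=
    (tendstoUniformlyOn_iff_tendstoUniformlyOnFilter.1 (hC.tendstoUniformlyOn_of_tendsto hG't)).mono_right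
      (le_principal_iff.2 hU)
  have hdf : ∀ᶠ p : ι × E in l ×ˢ 𝓝 x, HasFDerivAt (φ p.1) (fderiv ℝ (φ p.1) p.2) p.2 := by
    filter_upwards [hdiff.prod_mk (eventually_mem_set.2 hU)] with p hp
    exact (hp.1 p.2 hp.2).hasFDerivAt
  have hφ0 : ∀ᶠ y in 𝓝 x, Tendsto (fun i => φ i y) l (𝓝 ((fun _ : E => (0 : G)) y)) := by
    filter_upwards [hU] with y hy using h0 y hy
  have hD : HasFDerivAt (fun _ : E => (0 : G)) (G' x) x :=
    hasFDerivAt_of_tendstoUniformlyOnFilter (f := φ) (g := fun _ : E => (0 : G))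
      (f' := fun i y => fderiv ℝ (φ i) y) (g' := G') hf' hdf hφ0
  rw [← show G' x = 0 from hD.unique (hasFDerivAt_const (0 : G) x)]
  exact hG't x (mem_of_mem_nhds hU)

/-- **SL — all spatial derivatives of the difference vanish at the final slice off the apex** (registered
sub-goal of `stub_farFieldAllOrders`): for two fields jointly smooth on the open backward slab with the
time-derivative bounds of the scale-invariant package and the same scar, `∇ᵏV₁(s,x) − ∇ᵏV₂(s,x) → 0` as
`s ↑ 0` for every `k` and `x ≠ 0` (induction on `k`: the scar; then limits of derivatives). [folklore] -/
theorem stub_farFieldAllOrders_sliceLimit :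
    ∀ (V₁ V₂ : ℝ → ℝ³ → ℝ³), IsSmoothSpaceTimeOn (Iio (0 : ℝ)) V₁ → IsSmoothSpaceTimeOn (Iio (0 : ℝ)) V₂ →
      (∀ n : ℕ, ∃ L : ℝ, ∀ t < 0, ∀ x : ℝ³,
        ‖deriv (fun s => iteratedFDeriv ℝ n (V₁ s) x) t‖ ≤ L / (‖x‖ + Real.sqrt (-t)) ^ (3 + n)) →
      (∀ n : ℕ, ∃ L : ℝ, ∀ t < 0, ∀ x : ℝ³,
        ‖deriv (fun s => iteratedFDeriv ℝ n (V₂ s) x) t‖ ≤ L / (‖x‖ + Real.sqrt (-t)) ^ (3 + n)) →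
      SameScar V₁ V₂ → ∀ (k : ℕ) (x : ℝ³), x ≠ 0 →
      Tendsto (fun s => iteratedFDeriv ℝ k (V₁ s) x - iteratedFDeriv ℝ k (V₂ s) x) (𝓝[<] (0 : ℝ)) (𝓝 0) := by
  intro V₁ V₂ hV₁ hV₂ hT₁ hT₂ hscar k
  induction k with
  | zero =>
    intro x hx
    have h0 := tendsto_sub_of_sameScar hV₁ hV₂ hscar hx
    rw [tendsto_zero_iff_norm_tendsto_zero] at h0 ⊢
    refine h0.congr fun s => ?_
    rw [show iteratedFDeriv ℝ 0 (V₁ s) x - iteratedFDeriv ℝ 0 (V₂ s) x =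
      iteratedFDeriv ℝ 0 (fun z => V₁ s z - V₂ s z) x by ext m; simp, norm_iteratedFDeriv_zero]
  | succ k ih =>
    intro x hx
    obtain ⟨L₁, hL₁⟩ := hT₁ (k + 1)
    obtain ⟨L₂, hL₂⟩ := hT₂ (k + 1)
    have hL₁0 : 0 ≤ L₁ := nonneg_of_timeDeriv_bound hL₁
    have hL₂0 : 0 ≤ L₂ := nonneg_of_timeDeriv_bound hL₂
    have hxpos : 0 < ‖x‖ := norm_pos_iff.2 hx
    obtain ⟨r, hr⟩ : ∃ r : ℝ, r = ‖x‖ / 2 := ⟨_, rfl⟩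
    have hr0 : 0 < r := by rw [hr]; exact half_pos hxpos
    have hball : ∀ y ∈ ball x r, r ≤ ‖y‖ := by
      intro y hy
      rw [mem_ball, dist_eq_norm, norm_sub_rev] at hy
      have h1 : ‖x‖ - ‖y‖ ≤ ‖x - y‖ := norm_sub_norm_le x y
      rw [hr] at hy ⊢
      linarith
    have hball0 : ∀ y ∈ ball x r, y ≠ 0 := fun y hy h0 => by
      linarith [show r ≤ ‖y‖ from hball y hy, show ‖y‖ = 0 by rw [h0, norm_zero]]
    have hIio : ∀ᶠ s in 𝓝[<] (0 : ℝ), s < 0 := self_mem_nhdsWithin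
    -- the family `φ s = ∇ᵏ(V₁(s) − V₂(s))`: differentiable slices, pointwise limit `0` on the ball (induction
    -- hypothesis), derivatives uniformly Cauchy on the ball (time-Lipschitz bound at order `k + 1`)
    obtain ⟨φ, hφ⟩ : ∃ φ : ℝ → ℝ³ → (ℝ³ [×k]→L[ℝ] ℝ³),
        φ = fun s => iteratedFDeriv ℝ k (fun z => V₁ s z - V₂ s z) := ⟨_, rfl⟩
    have hdiff : ∀ᶠ s in 𝓝[<] (0 : ℝ), ∀ y ∈ ball x r, DifferentiableAt ℝ (φ s) y := by
      filter_upwards [hIio] with s hs y _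
      have hw : ContDiff ℝ (⊤ : ℕ∞) (fun z => V₁ s z - V₂ s z) :=
        (hV₁.contDiff_slice (t := s) hs).sub (hV₂.contDiff_slice (t := s) hs)
      rw [hφ]
      exact (hw.differentiable_iteratedFDeriv (by exact_mod_cast WithTop.coe_lt_top k)) y
    have h0 : ∀ y ∈ ball x r, Tendsto (fun s => φ s y) (𝓝[<] (0 : ℝ)) (𝓝 0) := by
      intro y hy
      refine (ih y (hball0 y hy)).congr' ?_
      filter_upwards [hIio] with s hs
      rw [hφ]
      exact (iteratedFDeriv_sub_slice hV₁ hV₂ k hs y).symm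
    have hC : UniformCauchySeqOn (fun s y => fderiv ℝ (φ s) y) (𝓝[<] (0 : ℝ)) (ball x r) := by
      refine uniformCauchySeqOn_nhdsLT_of_lipschitz (F := fun s y => fderiv ℝ (φ s) y) (U := ball x r)
        (M := (L₁ + L₂) / r ^ (3 + (k + 1))) (div_nonneg (add_nonneg hL₁0 hL₂0) (pow_nonneg hr0.le _)) ?_
      intro y hy s hs t ht
      simp only [hφ, fderiv_iteratedFDeriv, comp_apply]
      rw [iteratedFDeriv_sub_slice hV₁ hV₂ (k + 1) ht y, iteratedFDeriv_sub_slice hV₁ hV₂ (k + 1) hs y,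
        ← LinearIsometryEquiv.map_sub, LinearIsometryEquiv.norm_map]
      exact norm_iteratedFDeriv_sub_sub_le hV₁ hV₂ hL₁0 hL₂0 hr0 hL₁ hL₂ (hball y hy) hs ht
    -- limits of derivatives are derivatives of the limit `0`; back to order `k + 1` by the currying isometry
    have hlim := tendsto_fderiv_zero_of_uniformCauchy (ball_mem_nhds x hr0) hdiff h0 hC
    have h2 : Tendsto
        (fun s => (continuousMultilinearCurryLeftEquiv ℝ (fun _ : Fin (k + 1) => ℝ³) ℝ³).symm
          (fderiv ℝ (φ s) x)) (𝓝[<] (0 : ℝ))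
        (𝓝 ((continuousMultilinearCurryLeftEquiv ℝ (fun _ : Fin (k + 1) => ℝ³) ℝ³).symm 0)) :=
      ((continuousMultilinearCurryLeftEquiv ℝ (fun _ : Fin (k + 1) => ℝ³) ℝ³).symm.continuous.tendsto
        0).comp hlim
    rw [map_zero] at h2
    refine h2.congr' ?_
    filter_upwards [hIio] with s hs
    simp only [hφ, fderiv_iteratedFDeriv, comp_apply]
    rw [iteratedFDeriv_sub_slice hV₁ hV₂ (k + 1) hs x, LinearIsometryEquiv.symm_apply_apply]

/-- The closing algebra: `K/a^{3+k} · σ² = K σ⁻¹ (σ/a)³ / aᵏ` for `σ, a > 0`. [folklore] -/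
theorem farDecay_three_algebra (K : ℝ) {σ a : ℝ} (hσ : 0 < σ) (ha : 0 < a) (k : ℕ) :
    K / a ^ (3 + k) * σ ^ 2 = K * σ⁻¹ * (σ / a) ^ 3 / a ^ k := by
  field_simp
  ring

/-- **S-far — the scar makes the twins cubically flat on the parabolic exterior, with all derivatives.**
For two classical pairs with the scale-invariant package and the SAME SCAR, every spatial derivative of
`V₁ − V₂` is `O((−t)‖x‖^{−3−k})` on `√(−t) ≤ ‖x‖`: the derivatives `∇ᵏ(V₁−V₂)(s,x)` vanish as `s ↑ 0` off
the apex (`stub_farFieldAllOrders_sliceLimit`) and one integrates the bound `‖∂ₜ∇ᵏ(V₁−V₂)‖ ≤ (L₁+L₂)/‖x‖^{3+k}`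
back from the final slice (`norm_iteratedFDeriv_sub_sub_le`). [folklore] -/
theorem stub_farFieldAllOrders :
    ∀ (V₁ V₂ : ℝ → ℝ³ → ℝ³) (Q₁ Q₂ : ℝ → ℝ³ → ℝ),
      IsClassicalNSSolutionOn (Iio (0 : ℝ)) 1 0 V₁ Q₁ → IsClassicalNSSolutionOn (Iio (0 : ℝ)) 1 0 V₂ Q₂ →
      ScaleInvariantBounds V₁ Q₁ → ScaleInvariantBounds V₂ Q₂ → SameScar V₁ V₂ →
      FarDecay 3 V₁ V₂ := by
  intro V₁ V₂ Q₁ Q₂ hcl₁ hcl₂ hB₁ hB₂ hscar k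
  have hV₁ : IsSmoothSpaceTimeOn (Iio (0 : ℝ)) V₁ := hcl₁.smooth_velocity
  have hV₂ : IsSmoothSpaceTimeOn (Iio (0 : ℝ)) V₂ := hcl₂.smooth_velocity
  have hT₁ : ∀ n : ℕ, ∃ L : ℝ, ∀ t < 0, ∀ x : ℝ³,
      ‖deriv (fun s => iteratedFDeriv ℝ n (V₁ s) x) t‖ ≤ L / (‖x‖ + Real.sqrt (-t)) ^ (3 + n) :=
    fun n => (hB₁ n).imp fun L hL t ht x => (hL t ht x).2.2
  have hT₂ : ∀ n : ℕ, ∃ L : ℝ, ∀ t < 0, ∀ x : ℝ³,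
      ‖deriv (fun s => iteratedFDeriv ℝ n (V₂ s) x) t‖ ≤ L / (‖x‖ + Real.sqrt (-t)) ^ (3 + n) :=
    fun n => (hB₂ n).imp fun L hL t ht x => (hL t ht x).2.2
  obtain ⟨L₁, hL₁⟩ := hT₁ k
  obtain ⟨L₂, hL₂⟩ := hT₂ k
  have hL₁0 : 0 ≤ L₁ := nonneg_of_timeDeriv_bound hL₁
  have hL₂0 : 0 ≤ L₂ := nonneg_of_timeDeriv_bound hL₂
  refine ⟨L₁ + L₂, fun t ht x hx => ?_⟩
  have hσ : 0 < Real.sqrt (-t) := Real.sqrt_pos.2 (by linarith)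
  have hxpos : 0 < ‖x‖ := hσ.trans_le hx
  obtain ⟨M, hM⟩ : ∃ M : ℝ, M = (L₁ + L₂) / ‖x‖ ^ (3 + k) := ⟨_, rfl⟩
  have hM0 : 0 ≤ M := by rw [hM]; exact div_nonneg (add_nonneg hL₁0 hL₂0) (pow_nonneg hxpos.le _)
  -- `g(s) = ∇ᵏV₁(s,x) − ∇ᵏV₂(s,x)` tends to `0` as `s ↑ 0` and is `M`-Lipschitz on `s < 0`
  obtain ⟨g, hg⟩ : ∃ g : ℝ → (ℝ³ [×k]→L[ℝ] ℝ³),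
      g = fun s => iteratedFDeriv ℝ k (V₁ s) x - iteratedFDeriv ℝ k (V₂ s) x := ⟨_, rfl⟩
  have hlim : Tendsto g (𝓝[<] (0 : ℝ)) (𝓝 0) := by
    rw [hg]
    exact stub_farFieldAllOrders_sliceLimit V₁ V₂ hV₁ hV₂ hT₁ hT₂ hscar k x (norm_pos_iff.1 hxpos)
  have hmain : ‖g t‖ ≤ M * (-t) := by
    have hev : ∀ᶠ s in 𝓝[<] (0 : ℝ), ‖g t‖ ≤ M * (-t) + ‖g s‖ := by
      filter_upwards [Ioo_mem_nhdsLT ht] with s hs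
      have hmvt : ‖g t - g s‖ ≤ M * |t - s| := by
        rw [hg, hM]
        exact norm_iteratedFDeriv_sub_sub_le hV₁ hV₂ hL₁0 hL₂0 hxpos hL₁ hL₂ le_rfl hs.2 ht
      have habs : |t - s| ≤ -t := by
        rw [abs_of_nonpos (by linarith [hs.1])]
        linarith [hs.2]
      calc ‖g t‖ = ‖(g t - g s) + g s‖ := by rw [sub_add_cancel]
        _ ≤ ‖g t - g s‖ + ‖g s‖ := norm_add_le _ _
        _ ≤ M * |t - s| + ‖g s‖ := by linarith [hmvt]
        _ ≤ M * (-t) + ‖g s‖ := by linarith [mul_le_mul_of_nonneg_left habs hM0]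
    have hlim' : Tendsto (fun s => M * (-t) + ‖g s‖) (𝓝[<] (0 : ℝ))
        (𝓝 (M * (-t) + ‖(0 : ℝ³ [×k]→L[ℝ] ℝ³)‖)) := tendsto_const_nhds.add hlim.norm
    rw [norm_zero, add_zero] at hlim'
    exact ge_of_tendsto hlim' hev
  rw [show iteratedFDeriv ℝ k (fun y => V₁ t y - V₂ t y) x = g t by
    rw [hg]; exact iteratedFDeriv_sub_slice hV₁ hV₂ k ht x]
  calc ‖g t‖ ≤ M * (-t) := hmain
    _ = (L₁ + L₂) * (Real.sqrt (-t))⁻¹ * (Real.sqrt (-t) / ‖x‖) ^ 3 / ‖x‖ ^ k := by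
      have h3 := farDecay_three_algebra (L₁ + L₂) hσ hxpos k
      rw [Real.sq_sqrt (by linarith), ← hM] at h3
      exact h3

end Summit.NavierStokesRegularity.NavierStokesRegularity.Theorems.RellichScarScarRigidity

end
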